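import Literature.LinearAlgebra.Matrix.PermanentBooleanSumScheme
import Literature.LinearAlgebra.Matrix.PermanentBypass
import HarnessLib

/-!
# Absorbing a Boolean sum into a permanent: all two-site variables at once, explicitly

Continuation of `PermanentBooleanSum.lean` (the two-site gadget `boolSumGlue`,
`permanent_boolSumGlue : per (boolSumGlue A u₁ v₁ u₂ v₂ ε₁ ε₂) = 2 · (per A + per (A + ε₁E₁ + ε₂E₂))`)
and `PermanentBooleanSumScheme.lean` (`exists_boolSumScheme`: gluing one gadget per variable gives SOME
index type `κ`, an embedding and a constant matrix with `per = 2^t ∑_b per A(b)`). For Valiant's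
reduction `#3SAT → PERMANENT` as a polynomial-time map on strings (`Computability/QuantumComplexity/
PermanentHardness.lean`) the glued matrix has to be an EXPLICIT function of the data (the machine
writes its entries down one by one), so this file gives the all-at-once gadget in closed form:

* `Literature.LinearAlgebra.Matrix.glueAll A s` — for a family `s : Fin T → SitePair ι R` of
  two-site Boolean variables, the matrix on `ι ⊕ Fin T × Fin 4` whose first block is `A`, whose
  `k`-th group of four new indices carries the core `boolSumCore` and whose ports are those of
  `boolSumGlue` for the `k`-th site pair (no entries between different groups);
* `Literature.LinearAlgebra.Matrix.sitePoint A s b = A + ∑_k [b_k] (ε₁E_{u₁v₁} + ε₂E_{u₂v₂})_k`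
  (the `Fin T`-indexed form of `boolPoint`);
* **`Literature.LinearAlgebra.Matrix.permanent_glueAll`**:
  `per (glueAll A s) = 2^T · ∑_{b ∈ {0,1}^T} per (sitePoint A s b)` over any commutative ring,
  proved by peeling the last variable (`glueAll_submatrix_slotPeel`: after the re-indexing
  `slotPeel ι T 4` of `PermanentBypass.lean` the matrix IS `boolSumGlue` of the matrix glued on the
  first `T` variables) and `permanent_boolSumGlue`, the two summands being `glueAll` of `A` and of
  `A + (sites of the last variable)` (`glueAll_add`);
* `sitePoint_apply_of_injective` — the entries of `A(b)` when all `2T` sites are distinct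
  positions (the case of the CNF matrices downstream, whose sites all lie on the diagonal).

This is the division-free multiplicity-two form of Bürgisser–Clausen–Shokrollahi 1997, Thm. (21.29)
(there: char `≠ 2`, Valiant's `4 × 4` matrix, factor `4^{-2μ}`); here the factor `2^T` replaces the
division, as in Bürgisser 2009, proof of Thm. 2.10.

## References

* P. Bürgisser, M. Clausen, M. A. Shokrollahi, *Algebraic Complexity Theory*, Springer 1997,
  Thm. (21.29) and its proof.
* P. Bürgisser, *On defining integers and proving arithmetic circuit lower bounds*, Comput.
  Complexity 18 (2009), proof of Thm. 2.10.
* L. G. Valiant, *The complexity of computing the permanent*, TCS 8 (1979), proof of Lemma 3.1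
  (junctions coupling the occurrences of a variable).
-/

namespace Literature.LinearAlgebra.Matrix

open _root_.Matrix Equiv Finset

universe u

variable {ι : Type u} [DecidableEq ι] {R : Type*} [CommRing R]

/-! ### The all-at-once gadget -/

/-- **All two-site gadgets at once.** Index type `ι ⊕ Fin T × Fin 4`: the block `A` on `ι`, and for
the `k`-th site pair `(u₁, v₁, u₂, v₂, ε₁, ε₂)` four new indices `(k, 0..3)` carrying `boolSumCore`,
entered from row `u₁` at `(k, 0)` with weight `ε₁` and from row `u₂` at `(k, 1)` with weight `ε₂`,
leaving to column `v₁` from `(k, 0)` and to `v₂` from `(k, 1)` with weight `1`; no entries between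
different groups (BCS 1997, proof of Thm. (21.29): one block per variable). [cite: BurgisserClausenShokrollahi1997, Thm. (21.29)] -/
def glueAll (A : Matrix ι ι R) {T : ℕ} (s : Fin T → SitePair ι R) :
    Matrix (ι ⊕ Fin T × Fin 4) (ι ⊕ Fin T × Fin 4) R :=
  fun x y => match x, y with
  | Sum.inl j, Sum.inl i => A j i
  | Sum.inl j, Sum.inr (k, g) =>
      if g = 0 ∧ j = (s k).u₁ then (s k).ε₁ else if g = 1 ∧ j = (s k).u₂ then (s k).ε₂ else 0
  | Sum.inr (k, g), Sum.inl i =>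
      if g = 0 ∧ i = (s k).v₁ then 1 else if g = 1 ∧ i = (s k).v₂ then 1 else 0
  | Sum.inr (k, g), Sum.inr (k', g') => if k = k' then boolSumCore g g' else 0

/-- The matrix `A(b) = A + ∑_k [b_k] (ε₁ E_{u₁v₁} + ε₂ E_{u₂v₂})_k` at the Boolean point `b` of a
family of site pairs (`boolPoint` of `PermanentBooleanSumScheme.lean` for `Fin T`-indexed families). [cite: BurgisserClausenShokrollahi1997, Thm. (21.29)] -/
def sitePoint (A : Matrix ι ι R) {T : ℕ} (s : Fin T → SitePair ι R) (b : Fin T → Bool) : Matrix ι ι R :=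
  A + ∑ k, if b k then (s k).toMatrix else 0

section Entries

variable (A : Matrix ι ι R) {T : ℕ} (s : Fin T → SitePair ι R)

/-- Entries of `glueAll`, first block. [folklore] -/
@[simp] theorem glueAll_inl_inl (j i : ι) : glueAll A s (Sum.inl j) (Sum.inl i) = A j i := rfl

/-- Entries of `glueAll`, port columns. [folklore] -/
@[simp] theorem glueAll_inl_inr (j : ι) (k : Fin T) (g : Fin 4) :
    glueAll A s (Sum.inl j) (Sum.inr (k, g)) =
      if g = 0 ∧ j = (s k).u₁ then (s k).ε₁ else if g = 1 ∧ j = (s k).u₂ then (s k).ε₂ else 0 := rfl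

/-- Entries of `glueAll`, port rows. [folklore] -/
@[simp] theorem glueAll_inr_inl (k : Fin T) (g : Fin 4) (i : ι) :
    glueAll A s (Sum.inr (k, g)) (Sum.inl i) =
      if g = 0 ∧ i = (s k).v₁ then 1 else if g = 1 ∧ i = (s k).v₂ then 1 else 0 := rfl

/-- Entries of `glueAll`, cores. [folklore] -/
@[simp] theorem glueAll_inr_inr (k k' : Fin T) (g g' : Fin 4) :
    glueAll A s (Sum.inr (k, g)) (Sum.inr (k', g')) = if k = k' then boolSumCore g g' else 0 := rfl

/-- `glueAll` is additive in the first block (the ports and cores do not read `A`). [folklore] -/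
theorem glueAll_add (X : Matrix ι ι R) :
    glueAll (A + X) s = glueAll A s + fromBlocks X 0 0 (0 : Matrix (Fin T × Fin 4) (Fin T × Fin 4) R) := by
  ext x y
  rcases x with j | ⟨k, g⟩ <;> rcases y with i | ⟨k', g'⟩ <;> simp [glueAll]

/-- A single entry in the first block, as a block matrix. [folklore] -/
theorem fromBlocks_single_zero (u v : ι) (ε : R) :
    fromBlocks (single u v ε) 0 0 (0 : Matrix (Fin T × Fin 4) (Fin T × Fin 4) R) =
      single (Sum.inl u) (Sum.inl v) ε := by
  ext x y
  rcases x with j | ⟨k, g⟩ <;> rcases y with i | ⟨k', g'⟩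
  · simp only [fromBlocks_apply₁₁, single_apply, Sum.inl.injEq]
  · rw [fromBlocks_apply₁₂, single_apply_of_col_ne _ _ (by simp)]; rfl
  · rw [fromBlocks_apply₂₁, single_apply_of_row_ne (by simp)]; rfl
  · rw [fromBlocks_apply₂₂, single_apply_of_row_ne (by simp)]; rfl

/-- Adding the two sites of a pair inside the first block of `glueAll`. [folklore] -/
theorem glueAll_add_toMatrix (t : SitePair ι R) :
    glueAll A s + single (Sum.inl t.u₁) (Sum.inl t.v₁) t.ε₁ + single (Sum.inl t.u₂) (Sum.inl t.v₂) t.ε₂ =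
      glueAll (A + t.toMatrix) s := by
  rw [glueAll_add, SitePair.toMatrix, ← fromBlocks_single_zero, ← fromBlocks_single_zero, add_assoc,
    fromBlocks_add]
  simp only [add_zero]

end Entries

/-! ### Peeling the last variable -/

section Peel

variable (A : Matrix ι ι R) {T : ℕ} (s : Fin (T + 1) → SitePair ι R)

/-- **Peeling the last site pair**: after the re-indexing `slotPeel ι T 4`
(`(ι ⊕ Fin T × Fin 4) ⊕ Fin 4 ≃ ι ⊕ Fin (T+1) × Fin 4`), `glueAll A s` is the two-site gadget of the
last pair glued onto `glueAll A (s ∘ castSucc)`. [folklore] -/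
theorem glueAll_submatrix_slotPeel :
    (glueAll A s).submatrix (slotPeel ι T 4) (slotPeel ι T 4) =
      boolSumGlue (glueAll A (fun k => s (Fin.castSucc k))) (Sum.inl (s (Fin.last T)).u₁)
        (Sum.inl (s (Fin.last T)).v₁) (Sum.inl (s (Fin.last T)).u₂) (Sum.inl (s (Fin.last T)).v₂)
        (s (Fin.last T)).ε₁ (s (Fin.last T)).ε₂ := by
  ext x y
  rcases x with (j | ⟨k, g⟩) | g <;> rcases y with (i | ⟨k', g'⟩) | g'
  · rfl
  · rfl
  · simp [boolSumGlue, glueQ]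
  · rfl
  · simp only [submatrix_apply, slotPeel_inl_inr, glueAll_inr_inr, Fin.castSucc_inj, boolSumGlue,
      fromBlocks_apply₁₁]
  · simp [boolSumGlue, glueQ, (Fin.castSucc_lt_last k).ne]
  · simp [boolSumGlue, glueR]
  · simp [boolSumGlue, glueR, (Fin.castSucc_lt_last k').ne']
  · simp [boolSumGlue]

end Peel

/-! ### Boolean points -/

section Points

variable (A : Matrix ι ι R)

/-- `A(b)` for no variables is `A`. [folklore] -/
theorem sitePoint_zero (s : Fin 0 → SitePair ι R) (b : Fin 0 → Bool) : sitePoint A s b = A := by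
  simp [sitePoint]

/-- Splitting off the last variable: `A(b, c) = (A + [c] · s_T)(b)` for the first `T` pairs. [folklore] -/
theorem sitePoint_snoc {T : ℕ} (s : Fin (T + 1) → SitePair ι R) (b : Fin T → Bool) (c : Bool) :
    sitePoint A s (Fin.snoc b c) =
      sitePoint (A + if c then (s (Fin.last T)).toMatrix else 0) (fun k => s (Fin.castSucc k)) b := by
  simp only [sitePoint, Fin.sum_univ_castSucc, Fin.snoc_castSucc, Fin.snoc_last]
  rw [add_assoc, add_comm (∑ x : Fin T, _) _]

/-- Splitting a sum over Boolean points on the last variable. [folklore] -/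
theorem sum_sitePoint_succ {M : Type*} [AddCommMonoid M] {T : ℕ} (s : Fin (T + 1) → SitePair ι R)
    (F : Matrix ι ι R → M) :
    ∑ b : Fin (T + 1) → Bool, F (sitePoint A s b) =
      ∑ b : Fin T → Bool, F (sitePoint A (fun k => s (Fin.castSucc k)) b) +
        ∑ b : Fin T → Bool, F (sitePoint (A + (s (Fin.last T)).toMatrix) (fun k => s (Fin.castSucc k)) b) := by
  rw [← Fintype.sum_equiv (Fin.snocEquiv fun _ => Bool)
      (fun p => F (sitePoint A s (Fin.snoc p.2 p.1))) _ (fun _ => rfl), Fintype.sum_prod_type,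
    Fintype.sum_bool, add_comm]
  congr 1
  · refine Fintype.sum_congr _ _ fun b => ?_
    rw [sitePoint_snoc]; simp
  · refine Fintype.sum_congr _ _ fun b => ?_
    rw [sitePoint_snoc]; simp

/-- **Entries of `A(b)` when all sites are distinct positions**: at the first site of variable `k`
the entry is `A + [b_k] ε₁`, at the second `A + [b_k] ε₂`, elsewhere `A`. [folklore] -/
theorem sitePoint_apply {T : ℕ} (s : Fin T → SitePair ι R) (b : Fin T → Bool) (x y : ι) :
    sitePoint A s b x y = A x y + ∑ k, if b k then
      ((if (s k).u₁ = x ∧ (s k).v₁ = y then (s k).ε₁ else 0) +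
        (if (s k).u₂ = x ∧ (s k).v₂ = y then (s k).ε₂ else 0)) else 0 := by
  simp only [sitePoint, add_apply, Matrix.sum_apply]
  congr 1
  refine Finset.sum_congr rfl fun k _ => ?_
  by_cases hb : b k = true
  · simp only [hb, if_true, SitePair.toMatrix, add_apply, single_apply]
  · simp [hb]

end Points

/-! ### The permanent -/

section Main

variable [Fintype ι]

/-- **The permanent of the all-at-once gadget**: for every family of `T` two-site Boolean
variables (each pair of sites in distinct rows and distinct columns),
`per (glueAll A s) = 2^T · ∑_{b ∈ {0,1}^T} per (A + ∑_k [b_k] (ε₁E_{u₁v₁} + ε₂E_{u₂v₂})_k)`.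
Peel the last variable (`glueAll_submatrix_slotPeel`, `permanent_boolSumGlue`); the two summands are
the gadgets of `A` and of `A + (sites of the last variable)` on the first `T` variables
(`glueAll_add_toMatrix`), and the Boolean sum splits accordingly (`sum_sitePoint_succ`).
(BCS 1997, Thm. (21.29), division-free form: the factor `2^T` in place of the control entries
`4^{-2μ}`.) [cite: BurgisserClausenShokrollahi1997, Thm. (21.29)] -/
theorem permanent_glueAll (A : Matrix ι ι R) : ∀ {T : ℕ} (s : Fin T → SitePair ι R),
    (glueAll A s).permanent = 2 ^ T * ∑ b : Fin T → Bool, (sitePoint A s b).permanent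
  | 0, s => by
    rw [← permanent_submatrix_equiv (Equiv.sumEmpty ι (Fin 0 × Fin 4)).symm, Fintype.sum_unique,
      pow_zero, one_mul, sitePoint_zero]
    congr 1
  | T + 1, s => by
    have hu : (Sum.inl (s (Fin.last T)).u₁ : ι ⊕ Fin T × Fin 4) ≠ Sum.inl (s (Fin.last T)).u₂ :=
      fun h => (s (Fin.last T)).hu (Sum.inl_injective h)
    have hv : (Sum.inl (s (Fin.last T)).v₁ : ι ⊕ Fin T × Fin 4) ≠ Sum.inl (s (Fin.last T)).v₂ :=
      fun h => (s (Fin.last T)).hv (Sum.inl_injective h)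
    rw [← permanent_submatrix_equiv (slotPeel ι T 4), glueAll_submatrix_slotPeel,
      permanent_boolSumGlue _ _ _ _ _ _ _ hu hv, glueAll_add_toMatrix,
      permanent_glueAll A (fun k => s (Fin.castSucc k)),
      permanent_glueAll (A + (s (Fin.last T)).toMatrix) (fun k => s (Fin.castSucc k)),
      sum_sitePoint_succ A s (fun M => M.permanent), pow_succ]
    ring

end Main

end Literature.LinearAlgebra.Matrix
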